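import Literature.Algebra.Homology.SplitComplexFieldDecomposition
import Literature.Algebra.Homology.HomotopyEquivZeroDifferential
import HarnessLib

/-!
# Every complex of vector spaces is homotopy equivalent to its homology (Weibel Thm. 3.6.3, proof)

Layer `Literature/Algebra/Homology` (pure homological algebra over Mathlib; constructions + proved lemmas, 0 named facts, no instances, no
notation). With the splitting `Cⁿ = Bⁿ ⊕ ι s(Hⁿ) ⊕ Kⁿ`, `d : Kⁿ ≅ Bⁿ⁺¹` of `Algebra/Homology/SplitComplexFieldDecomposition` (any cochain
complex `C` of vector spaces over a field `k`), the GENERALISED INVERSE of the differential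
`t = splitInverse C n : Cⁿ⁺¹ ⟶ Cⁿ` (project onto `Bⁿ⁺¹`, invert `d|_K`, include `Kⁿ`) satisfies the two identities of
`Algebra/Homology/HomotopyEquivZeroDifferential` — `t ≫ d = r ≫ (𝟙 - π ≫ s) ≫ ι` (`splitInverse_comp_d`) and `d ≫ t = 𝟙 - r ≫ ι`
(`d_comp_splitInverse`) — whence

* **`homotopyEquivHomologyOfField C : HomotopyEquiv C (zeroDifferential (up ℤ) (H• C))`**: over a field the quasi-isomorphism
  `C ⟶ (H•(C), 0)` of `Algebra/Homology/QuasiIsoToHomology` is part of a homotopy equivalence (homotopies survive tensoring — the input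
  of the Künneth formula for unbounded complexes).

Library only (cell `pub-hodge-ring2`, count-neutral); proves nothing about any crux, route or conjecture. Mathlib searched (pin v4.32):
`Submodule.projection_apply_of_mem_left`, `projection_apply_eq_zero_iff`, `LinearEquiv.symm_apply_eq`, `HomotopyEquiv` (used).

## References

* C. A. Weibel, *An introduction to homological algebra* (1994), Thm. 3.6.3 (proof), Ex. 1.4.3. [Weibel1994]
* H. Cartan, S. Eilenberg, *Homological Algebra* (1956), VI.3, Thm. 3.1. [CartanEilenberg1956]
-/

noncomputable section

open CategoryTheory CategoryTheory.Category CategoryTheory.Limits HomologicalComplex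

universe u

namespace Literature.Algebra.Homology

variable {k : Type u} [Field k] (C : CochainComplex (ModuleCat.{u} k) ℤ)

/-- The projection `Cⁿ⁺¹ → Cⁿ⁺¹` onto the boundaries along `ι s Hⁿ⁺¹ ⊕ Kⁿ⁺¹`. [cite: Weibel1994, Thm. 3.6.3 (proof)] -/
def boundariesProjection (n : ℤ) : C.X (n + 1) →ₗ[k] C.X (n + 1) :=
  (LinearMap.range (C.d n (n + 1)).hom).projection _ (isCompl_boundaries C n)

/-- **`t : Cⁿ⁺¹ ⟶ Cⁿ`**: project onto the boundaries, invert `d|_K`, include `Kⁿ ⊆ Cⁿ`. [cite: Weibel1994, Thm. 3.6.3 (proof)] [cite: Weibel1994, Ex. 1.4.3] -/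
def splitInverse (n : ℤ) : C.X (n + 1) ⟶ C.X n :=
  ModuleCat.ofHom ((splitCompl C n).subtype ∘ₗ (splitComplEquivBoundaries C n).symm.toLinearMap ∘ₗ
    LinearMap.codRestrict _ (boundariesProjection C n) fun x => Submodule.projection_apply_mem _ x)

/-- `d (t x) = pB x`. [cite: Weibel1994, Thm. 3.6.3 (proof)] -/
theorem d_splitInverse_apply (n : ℤ) (x : C.X (n + 1)) :
    (C.d n (n + 1)).hom ((splitInverse C n).hom x) = boundariesProjection C n x := by
  change (C.d n (n + 1)).hom ((splitCompl C n).subtype ((splitComplEquivBoundaries C n).symm _)) = _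
  rw [Submodule.subtype_apply, ← splitComplEquivBoundaries_apply_coe, LinearEquiv.apply_symm_apply]
  rfl

/-- `t (d x) = x - pZ x`. [cite: Weibel1994, Thm. 3.6.3 (proof)] -/
theorem splitInverse_d_apply (n : ℤ) (x : C.X n) :
    (splitInverse C n).hom ((C.d n (n + 1)).hom x) = x - cyclesProjection C n x := by
  have hmem : (C.d n (n + 1)).hom x ∈ LinearMap.range (C.d n (n + 1)).hom := LinearMap.mem_range_self _ x
  have h1 : LinearMap.codRestrict _ (boundariesProjection C n) (fun x => Submodule.projection_apply_mem _ x)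
      ((C.d n (n + 1)).hom x) = ⟨_, hmem⟩ :=
    Subtype.ext (Submodule.projection_apply_of_mem_left _ hmem)
  have h2 : (splitComplEquivBoundaries C n).symm ⟨_, hmem⟩ =
      ⟨x - cyclesProjection C n x, Submodule.sub_projection_mem (isCompl_cycles_splitCompl C n) x⟩ := by
    rw [LinearEquiv.symm_apply_eq]
    apply Subtype.ext
    rw [splitComplEquivBoundaries_apply_coe, Submodule.coe_mk, map_sub, d_cyclesProjection_apply, sub_zero]
  change (splitCompl C n).subtype ((splitComplEquivBoundaries C n).symm
    (LinearMap.codRestrict _ (boundariesProjection C n) (fun x => Submodule.projection_apply_mem _ x)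
      ((C.d n (n + 1)).hom x))) = _
  rw [h1, h2]
  rfl

/-- **`d ≫ t = 𝟙 - r ≫ ι`** (the projection onto `Kⁿ`). [cite: Weibel1994, Ex. 1.4.3] -/
theorem d_comp_splitInverse (n : ℤ) :
    C.d n (n + 1) ≫ splitInverse C n = 𝟙 _ - splitRetraction C n ≫ C.iCycles n := by
  ext x
  rw [splitRetraction_comp_iCycles]
  change (splitInverse C n).hom ((C.d n (n + 1)).hom x) = x - cyclesProjection C n x
  exact splitInverse_d_apply C n x

/-- **`t ≫ d = r ≫ (𝟙 - π ≫ s) ≫ ι`** (the projection onto `Bⁿ⁺¹`). [cite: Weibel1994, Ex. 1.4.3] -/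
theorem splitInverse_comp_d (n : ℤ) :
    splitInverse C n ≫ C.d n (n + 1) =
      splitRetraction C (n + 1) ≫ (𝟙 _ - C.homologyπ (n + 1) ≫ splitSection C (n + 1)) ≫ C.iCycles (n + 1) := by
  ext x
  change (C.d n (n + 1)).hom ((splitInverse C n).hom x) =
    (C.iCycles (n + 1)).hom (((𝟙 _ - C.homologyπ (n + 1) ≫ splitSection C (n + 1))).hom ((splitRetraction C (n + 1)).hom x))
  rw [d_splitInverse_apply, ModuleCat.hom_sub, ModuleCat.hom_id, LinearMap.sub_apply, LinearMap.id_apply, ModuleCat.hom_comp,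
    LinearMap.comp_apply, map_sub, iCycles_splitRetraction_apply]
  -- decompose `x` along `B ⊕ (ι s H ⊕ K)`
  set z := (splitRetraction C (n + 1)).hom x with hzdef
  have hz : (C.iCycles (n + 1)).hom z = cyclesProjection C (n + 1) x := iCycles_splitRetraction_apply C (n + 1) x
  have hK := Submodule.sub_projection_mem (isCompl_cycles_splitCompl C (n + 1)) x
  have hx : x = ((C.iCycles (n + 1)).hom z -
      (C.iCycles (n + 1)).hom ((splitSection C (n + 1)).hom ((C.homologyπ (n + 1)).hom z))) +
      ((C.iCycles (n + 1)).hom ((splitSection C (n + 1)).hom ((C.homologyπ (n + 1)).hom z)) +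
        (x - cyclesProjection C (n + 1) x)) := by
    rw [hz]; abel
  have hL : (C.iCycles (n + 1)).hom ((splitSection C (n + 1)).hom ((C.homologyπ (n + 1)).hom z)) +
      (x - cyclesProjection C (n + 1) x) ∈
        LinearMap.range ((C.iCycles (n + 1)).hom ∘ₗ (splitSection C (n + 1)).hom) ⊔ splitCompl C (n + 1) :=
    Submodule.add_mem_sup (LinearMap.mem_range_self _ _) hK
  conv_lhs => rw [hx]
  rw [boundariesProjection, map_add, Submodule.projection_apply_of_mem_left _ (iCycles_sub_mem_range_d C n z),
    (Submodule.projection_apply_eq_zero_iff _).2 hL, add_zero, hz]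

/-- **Over a field every cochain complex is homotopy equivalent to its homology with zero differentials.**
[cite: Weibel1994, Thm. 3.6.3] [cite: CartanEilenberg1956, VI.3 Thm. 3.1] -/
def homotopyEquivHomologyOfField : HomotopyEquiv C (zeroDifferential (ComplexShape.up ℤ) (fun i => C.homology i)) :=
  homotopyEquivZeroDifferential C (splitRetraction C) (iCycles_comp_splitRetraction C) (splitSection C) (splitInverse C)
    (splitSection_comp_homologyπ C) (splitInverse_comp_d C) (d_comp_splitInverse C)

end Literature.Algebra.Homology

end
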